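import Summits.ValiantsHypothesis.ValiantsHypothesis.Theorems.NewtonUnitEquationsTwoProductsRankOneThreeFreeLawSlice
import HarnessLib

/-!
# Route NewtonUnitEquations — crux `TwoProducts` (stmt-ValiantsHypothesis-5906), line `relation_ladder`, rung R7a (three-term
# rank one, GENERAL shape `α = qβ + rγ`, `q, r ≥ 1`): the FREE LIFT with DOUBLE SLICING — `RankOneThreeFreeLaw` — part 3/6 — exceptional exponents, the support criterion, the slice/reduced-part bijection (T4, second half)

(T4, end) exceptional exponents (`exc_apply`, `multinomial_exc`, `Fsl_exc`, `coeff_free_logTrunc_exc`), the support criterion `mem_support_free_logTrunc_iff`, the shape lemma, `Fsl_zero_zero`, `xOf`.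

val-idea-8 g3 (ideator; lens decomp), 2026-08-28. Generalises the R6b module (`α = β + γ`, val-lit-p3 g15's port `…RankOneThreeLaw*`,
imported): the substitution `Y_α ↦ Y_β^q Y_γ^r` has fibres `{x + k(e_α − q e_β − r e_γ)}` of letter count `n_k = R + B_k`, `R = Σ_{rest} x_j`,
`B_k = x_β + x_γ − (q+r−1)k ≥ 0`; slicing BOTH relation coordinates `(b₁, b₂) = (x_β, x_γ)` makes `multinomial(L_k)/n_k = Pfac(x) ·
C(R + B_k − 1, B_k) · κ_k` EXACT with `Pfac = (R−1)!/∏_{rest} x_j!`, so the slice functions are R6b's with `(b − k) ↦ B_k` and no binomial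
character — finite SHIFT RANK, and val-lit-p3's `ShiftRank.pencilCount` applies BY NAME.  Large coefficients (`q > m` or `r > m`) force
permutation type (`msetT a e ≤ m`), handled by R3♯ `permTypeLaw_proof`.

PORT NOTE (val-lit-p3 g15, prover seat, helper mode `--supports stmt-ValiantsHypothesis-5906 --as helper`, no stub credit claimed; the
author's invitation val-width INBOX 11:42Z + desk RULING #279 (c)): part 3/6 of a VERBATIM Theorems-side port of val-idea-8 g3's sorry-free
module `Cruxes/TwoProducts/Lines/relation_ladder_R7a.lean` (tree @0a494ab61a34; sha256 2455bfd4f3ef04f6…; 1 627 lines; `lean check` rc 0,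
0 sorries, 0 warnings). ALL mathematics and ALL proofs are val-idea-8 g3's (engine memo `Lines/relation_ladder_R7_engine.md` rev 2 §7).  The
port changes only: (i) the file split and the import chain; (ii) declarations that the source re-declares VERBATIM from the landed R6b port
(`sum_sgn`, `HSD` + `HSD.mul/mulHom/homMul/constMul/sum/add`, `hsd_binChar`, `rW_pos`) or from the R6 port (`tab`, `sgn`, `rW`,
`toolBound_mono`) or from `…FormalLogLinearisationStubRaysRung` (`wt_nsmul'` = `wt_nsmul`) are NOT re-declared but referenced BY NAME
(`R6b.…` for the sibling namespace); (iii) the section variables are renamed `I ↦ Iq` (the `QIdx` datum) and `D ↦ Dq` (the `RelData`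
datum) — a pure α-renaming forced by the gate's statement-text index (`dedup.landed` keys on declaration text, namespace-blind, and
the R6b port owns same-text lemmas over `ThreeIdx`); (iv) one-line docstrings on API lemmas; (v) in part 6/6 the parameter-free
`def RankOneThreeFreeLaw : Prop` is NOT declared (relocation rule) — the law is stated by its LITERAL body as `rankOneThreeFreeLaw_proof`.
Namespace = the author's (`…PermutationType.R7a`).  Nothing here closes the line's residual, the crux `TwoProducts` (5906) or `VP ≠ VNP`;
no summit statement is proved.

Honest scope (the author's): relations with the lone letter carrying a coefficient `p ≥ 2` (e.g. `2β = α + γ` = R6c, `pβ = qα + rγ`), two-letter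
`pα = qβ`, support ≥ 4 and coincidence rank ≥ 2 are NOT covered here.  Nothing here moves VP ≠ VNP; `TwoProducts` (5906) stays OPEN. [folklore]
-/

noncomputable section

-- Sub = Summit single-conjunct layout: the duplicated namespace component is mandated by the tree.
set_option linter.dupNamespace false
set_option linter.unusedSimpArgs false
set_option linter.deprecated false
set_option linter.unusedSectionVars false
set_option linter.unusedVariables false
set_option linter.unnecessarySeqFocus false

namespace Summit.ValiantsHypothesis.ValiantsHypothesis.Theorems.NewtonUnitEquations.TwoProducts.PermutationType
namespace R7a
open scoped BigOperators
open MvPolynomial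

variable {σ : Type*} [Fintype σ] [DecidableEq σ]

variable (Iq : QIdx σ)

section Slice
variable {m : ℕ}

/-- `exc_apply` — technical lemma of the R7a free-lift toolkit (val-idea-8 g3). [folklore] -/
theorem exc_apply (x : σ →₀ ℕ) (hx : x Iq.a = 0) (h0 : deg (xhat Iq x) = 0) (j : σ) (hjb : j ≠ Iq.b) (hjc : j ≠ Iq.c) :
    x j = 0 := by
  have hz : xhat Iq x = 0 := (deg_eq_zero_iff _).mp h0
  by_cases hja : j = Iq.a
  · rw [hja, hx]
  · have := DFunLike.congr_fun hz j
    rwa [xhat_other Iq x j hja hjb hjc] at this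

/-- `xhat_exc_apply` — technical lemma of the R7a free-lift toolkit (val-idea-8 g3). [folklore] -/
theorem xhat_exc_apply (x : σ →₀ ℕ) (h0 : deg (xhat Iq x) = 0) (j : σ) : xhat Iq x j = 0 := by
  rw [(deg_eq_zero_iff _).mp h0]; rfl

/-- `restProd_exc` — technical lemma of the R7a free-lift toolkit (val-idea-8 g3). [folklore] -/
theorem restProd_exc (t : σ → ℂ) (x : σ →₀ ℕ) (h0 : deg (xhat Iq x) = 0) : restProd Iq t ⇑(xhat Iq x) = 1 := by
  unfold restProd
  exact Finset.prod_eq_one fun j _ => by rw [xhat_exc_apply Iq x h0 j, pow_zero]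

/-- `multinomial_exc` — technical lemma of the R7a free-lift toolkit (val-idea-8 g3). [folklore] -/
theorem multinomial_exc (x : σ →₀ ℕ) (hx : x Iq.a = 0) (h0 : deg (xhat Iq x) = 0) (k : ℕ) (hk : k ∈ KR Iq x) :
    ((Lof Iq x k).multinomial : ℂ) = kap Iq (x Iq.b) (x Iq.c) k := by
  have hdeg := deg_Lof_eq Iq x k hk
  rw [h0, zero_add] at hdeg
  have s := Nat.multinomial_spec (Finset.univ : Finset σ) (Lof Iq x k)
  rw [← multinomial_univ, ← deg_eq_sum, prod_three_split Iq, Lof_a, Lof_b, Lof_c, hdeg] at s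
  have hr : ∏ j ∈ rest Iq, ((Lof Iq x k) j).factorial = 1 := by
    refine Finset.prod_eq_one fun j hj => ?_
    rw [mem_rest] at hj
    rw [Lof_other Iq x k j hj.1 hj.2.1 hj.2.2, exc_apply Iq x hx h0 j hj.2.1 hj.2.2, Nat.factorial_zero]
  rw [hr, one_mul] at s
  have hKd : (((k.factorial * (x Iq.b - Iq.q * k).factorial * (x Iq.c - Iq.r * k).factorial : ℕ)) : ℂ) ≠ 0 :=
    Nat.cast_ne_zero.mpr (Nat.mul_ne_zero (Nat.mul_ne_zero (Nat.factorial_ne_zero _) (Nat.factorial_ne_zero _))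
      (Nat.factorial_ne_zero _))
  unfold kap
  rw [eq_div_iff hKd]
  have e : (((k.factorial * ((x Iq.b - Iq.q * k).factorial * (x Iq.c - Iq.r * k).factorial) * (Lof Iq x k).multinomial : ℕ)) : ℂ) =
      (((Bk Iq (x Iq.b) (x Iq.c) k).factorial : ℕ) : ℂ) := by exact_mod_cast s
  push_cast at e ⊢
  linear_combination e

/-- `Bk_pos` — technical lemma of the R7a free-lift toolkit (val-idea-8 g3). [folklore] -/
theorem Bk_pos {b₁ b₂ k : ℕ} (hk : Iq.q * k ≤ b₁ ∧ Iq.r * k ≤ b₂) (hb : 1 ≤ b₁ + b₂) : 1 ≤ Bk Iq b₁ b₂ k := by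
  have := le_qmul Iq k
  unfold Bk
  rcases Nat.eq_zero_or_pos k with hk0 | hk0
  · subst hk0; simp; omega
  · omega

/-- `Bk_le` — technical lemma of the R7a free-lift toolkit (val-idea-8 g3). [folklore] -/
theorem Bk_le {b₁ b₂ k : ℕ} (hk : Iq.q * k ≤ b₁ ∧ Iq.r * k ≤ b₂) : Bk Iq b₁ b₂ k ≤ b₁ + b₂ := by
  have := le_qmul Iq k
  unfold Bk; omega

/-- The signed atom sum of the constants of an admissible `k`. [folklore] -/
theorem sum_mainConst (c d : Fin m → σ → ℂ) (b₁ b₂ k : ℕ) (hk : Iq.q * k ≤ b₁ ∧ Iq.r * k ≤ b₂) :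
    ∑ j, mainConst Iq c d b₁ b₂ j k = (-1 : ℂ) ^ ((Iq.q + Iq.r + 1) * k) * kap Iq b₁ b₂ k *
      (∑ j : Fin m, c j Iq.a ^ k * c j Iq.b ^ (b₁ - Iq.q * k) * c j Iq.c ^ (b₂ - Iq.r * k) -
        ∑ j : Fin m, d j Iq.a ^ k * d j Iq.b ^ (b₁ - Iq.q * k) * d j Iq.c ^ (b₂ - Iq.r * k)) := by
  rw [Fintype.sum_sum_type]
  simp only [mainConst, gd_pos Iq hk, tab, sgn, Sum.elim_inl, Sum.elim_inr]
  rw [mul_sub, Finset.mul_sum, Finset.mul_sum, sub_eq_add_neg, ← Finset.sum_neg_distrib]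
  congr 1
  · exact Finset.sum_congr rfl fun j _ => by ring
  · exact Finset.sum_congr rfl fun j _ => by ring

/-- The slice function at the exceptional point: only the correction survives. [folklore] -/
theorem Fsl_exc (c d : Fin m → σ → ℂ) (b₁ b₂ : ℕ) (hb : 1 ≤ b₁ + b₂) (ν : σ → ℕ) (hν : ∀ j, ν j = 0) :
    Fsl Iq c d b₁ b₂ ν = ∑ j : Fin m ⊕ Fin m, ∑ k : Fin (b₁ + b₂ + 1), mainConst Iq c d b₁ b₂ j k / ((Bk Iq b₁ b₂ k : ℕ) : ℂ) := by
  have hmain : ∑ j : Fin m ⊕ Fin m, ∑ k : Fin (b₁ + b₂ + 1), mainTerm Iq c d b₁ b₂ j k ν = 0 := by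
    refine Finset.sum_eq_zero fun j _ => Finset.sum_eq_zero fun k _ => ?_
    unfold mainTerm
    by_cases hk : Iq.q * k ≤ b₁ ∧ Iq.r * k ≤ b₂
    · have hlam : lam Iq ν = 0 := by unfold lam; simp [hν]
      have hB := Bk_pos Iq hk hb
      rw [hlam, Nat.choose_eq_zero_of_lt (by omega)]
      simp
    · rw [mainConst_eq_zero Iq c d hk j, zero_mul]
  unfold Fsl
  rw [hmain, mul_zero, zero_add]
  unfold corr
  rw [if_pos hν]

/-- **THE COEFFICIENT THEOREM at the exceptional exponent** `x = b₁ e_β + b₂ e_γ ≠ 0`. [folklore] -/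
theorem coeff_free_logTrunc_exc (c d : Fin m → σ → ℂ) (R : ℕ) (x : σ →₀ ℕ) (hx : x Iq.a = 0)
    (h0 : deg (xhat Iq x) = 0) (hbc : 1 ≤ x Iq.b + x Iq.c) (hR : deg x ≤ R) :
    coeff x (phiT (frM Iq) (logTrunc c d R)) =
      (-1 : ℂ) ^ (x Iq.b + x Iq.c + 1) * Fsl Iq c d (x Iq.b) (x Iq.c) ⇑(xhat Iq x) := by
  classical
  rw [coeff_phiT_frM Iq _ x hx]
  have hdx : deg x = x Iq.b + x Iq.c := by rw [deg_eq_deg_xhat_add Iq x, hx, h0, zero_add, zero_add]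
  have hz : ∀ j, (xhat Iq x) j = 0 := xhat_exc_apply Iq x h0
  rw [Fsl_exc Iq c d (x Iq.b) (x Iq.c) hbc _ hz, Finset.sum_comm, Finset.mul_sum]
  rw [Fin.sum_univ_eq_sum_range (fun k => (-1 : ℂ) ^ (x Iq.b + x Iq.c + 1) *
    ∑ j : Fin m ⊕ Fin m, mainConst Iq c d (x Iq.b) (x Iq.c) j k / ((Bk Iq (x Iq.b) (x Iq.c) k : ℕ) : ℂ)) (x Iq.b + x Iq.c + 1)]
  unfold KR
  rw [Finset.sum_filter]
  refine Finset.sum_congr rfl fun k _ => ?_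
  by_cases hk : Iq.q * k ≤ x Iq.b ∧ Iq.r * k ≤ x Iq.c
  · rw [if_pos hk]
    have hkm : k ∈ KR Iq x := (mem_KR Iq x k).2 hk
    have hdeg := deg_Lof_eq Iq x k hkm
    rw [h0, zero_add] at hdeg
    have hB1 := Bk_pos Iq hk hbc
    have hBle := Bk_le Iq hk
    have hdeg1 : 1 ≤ deg (Lof Iq x k) := by omega
    have hdegR : deg (Lof Iq x k) ≤ R := by omega
    rw [coeff_logTrunc c d R _ hdeg1 hdegR, multinomial_exc Iq x hx h0 k hkm, hdeg]
    have hsign : (-1 : ℂ) ^ (Bk Iq (x Iq.b) (x Iq.c) k + 1) = (-1) ^ (x Iq.b + x Iq.c + 1) * (-1) ^ ((Iq.q + Iq.r + 1) * k) := by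
      have e : x Iq.b + x Iq.c + 1 + (Iq.q + Iq.r + 1) * k = (Bk Iq (x Iq.b) (x Iq.c) k + 1) + 2 * (Iq.q * k + Iq.r * k) := by
        rw [qr_mul]; unfold Bk; omega
      rw [← pow_add, e, pow_add (-1 : ℂ) (Bk Iq (x Iq.b) (x Iq.c) k + 1), pow_mul]
      norm_num
    rw [hsign, ← Finset.sum_div, sum_mainConst Iq c d _ _ k hk]
    simp only [mom_Lof Iq _ x k, restProd_exc Iq _ x h0, mul_one]
    ring
  · rw [if_neg hk]
    rw [Finset.sum_eq_zero (fun j _ => by rw [mainConst_eq_zero Iq c d hk j, zero_div]), mul_zero]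

/-- **The support criterion**: `x ≠ 0` with `x_a = 0` and `deg x ≤ R` lies in the support of the free lift of `Λ_R` iff
`F_{x_b, x_c}(x̂) ≠ 0`. [folklore] -/
theorem mem_support_free_logTrunc_iff (c d : Fin m → σ → ℂ) (R : ℕ) (x : σ →₀ ℕ) (hx : x Iq.a = 0) (hne : x ≠ 0)
    (hR : deg x ≤ R) :
    x ∈ (phiT (frM Iq) (logTrunc c d R)).support ↔ Fsl Iq c d (x Iq.b) (x Iq.c) ⇑(xhat Iq x) ≠ 0 := by
  rw [mem_support_iff]
  by_cases h1 : 1 ≤ deg (xhat Iq x)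
  · rw [coeff_free_logTrunc Iq c d R x hx h1 hR]
    have hc : (-1 : ℂ) ^ (deg x + 1) * Pfac Iq x ≠ 0 :=
      mul_ne_zero (pow_ne_zero _ (neg_ne_zero.mpr one_ne_zero)) (Pfac_ne_zero Iq x)
    constructor
    · intro h hF; exact h (by rw [hF, mul_zero])
    · intro h; exact mul_ne_zero hc h
  · have h0 : deg (xhat Iq x) = 0 := by omega
    have hbc : 1 ≤ x Iq.b + x Iq.c := by
      by_contra h
      apply hne
      ext j
      by_cases hjb : j = Iq.b
      · subst hjb; simp; omega
      by_cases hjc : j = Iq.c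
      · subst hjc; simp; omega
      rw [exc_apply Iq x hx h0 j hjb hjc]; rfl
    rw [coeff_free_logTrunc_exc Iq c d R x hx h0 hbc hR]
    have hc : (-1 : ℂ) ^ (x Iq.b + x Iq.c + 1) ≠ 0 := pow_ne_zero _ (neg_ne_zero.mpr one_ne_zero)
    constructor
    · intro h hF; exact h (by rw [hF, mul_zero])
    · intro h; exact mul_ne_zero hc h

/-- Non-vanishing of a slice function forces `ν_a = ν_b = ν_c = 0`. [folklore] -/
theorem shape_of_Fsl_ne_zero (c d : Fin m → σ → ℂ) (b₁ b₂ : ℕ) (ν : σ → ℕ) (h : Fsl Iq c d b₁ b₂ ν ≠ 0) :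
    ν Iq.a = 0 ∧ ν Iq.b = 0 ∧ ν Iq.c = 0 := by
  by_contra hcon
  apply h
  unfold Fsl ind corr
  rw [if_neg hcon, zero_mul, zero_add, if_neg]
  intro hall
  exact hcon ⟨hall Iq.a, hall Iq.b, hall Iq.c⟩

/-- The slice function of the slice `(0, 0)` vanishes at the origin (equal numbers of `±` atoms). [folklore] -/
theorem Fsl_zero_zero (c d : Fin m → σ → ℂ) (ν : σ → ℕ) (hν : ∀ j, ν j = 0) : Fsl Iq c d 0 0 ν = 0 := by
  have hB : Bk Iq 0 0 0 = 0 := by unfold Bk; simp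
  have hkap : kap Iq 0 0 0 = 1 := by unfold kap; rw [hB]; simp
  have hgd : gd Iq 0 0 0 = 1 := by unfold gd; simp
  have hmain : ∀ j : Fin m ⊕ Fin m, ∑ k : Fin (0 + 0 + 1), mainTerm Iq c d 0 0 j k ν = sgn m j := by
    intro j
    rw [Fin.sum_univ_one]
    show mainTerm Iq c d 0 0 j 0 ν = sgn m j
    unfold mainTerm mainConst restProd
    rw [hgd, hkap, hB]
    simp [hν]
  have hcorr : corr Iq c d 0 0 ν = 0 := by
    unfold corr
    rw [if_pos hν]
    have : ∀ j : Fin m ⊕ Fin m, ∑ k : Fin (0 + 0 + 1), mainConst Iq c d 0 0 j k / ((Bk Iq 0 0 k : ℕ) : ℂ) = 0 := by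
      intro j
      rw [Fin.sum_univ_one]
      show mainConst Iq c d 0 0 j 0 / ((Bk Iq 0 0 0 : ℕ) : ℂ) = 0
      rw [hB]; simp
    simp only [this, Finset.sum_const_zero]
  unfold Fsl
  rw [hcorr, add_zero]
  simp only [hmain, R6b.sum_sgn, mul_zero]

/-- The exponent with prescribed slices `(b₁, b₂)` and reduced part `ν` (`ν_a = ν_b = ν_c = 0`). [folklore] -/
def xOf (b₁ b₂ : ℕ) (ν : σ → ℕ) : σ →₀ ℕ :=
  ofFun fun j => if j = Iq.b then b₁ else if j = Iq.c then b₂ else if j = Iq.a then 0 else ν j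

/-- `xOf_b` — technical lemma of the R7a free-lift toolkit (val-idea-8 g3). [folklore] -/
theorem xOf_b (b₁ b₂ : ℕ) (ν : σ → ℕ) : xOf Iq b₁ b₂ ν Iq.b = b₁ := by
  simp [xOf]

/-- `xOf_c` — technical lemma of the R7a free-lift toolkit (val-idea-8 g3). [folklore] -/
theorem xOf_c (b₁ b₂ : ℕ) (ν : σ → ℕ) : xOf Iq b₁ b₂ ν Iq.c = b₂ := by
  simp [xOf, Iq.hbc.symm]

/-- `xOf_a` — technical lemma of the R7a free-lift toolkit (val-idea-8 g3). [folklore] -/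
theorem xOf_a (b₁ b₂ : ℕ) (ν : σ → ℕ) : xOf Iq b₁ b₂ ν Iq.a = 0 := by
  simp [xOf, Iq.hab, Iq.hac]

/-- `xhat_xOf` — technical lemma of the R7a free-lift toolkit (val-idea-8 g3). [folklore] -/
theorem xhat_xOf (b₁ b₂ : ℕ) (ν : σ → ℕ) (ha : ν Iq.a = 0) (hb : ν Iq.b = 0) (hc : ν Iq.c = 0) :
    ⇑(xhat Iq (xOf Iq b₁ b₂ ν)) = ν := by
  funext j
  by_cases hja : j = Iq.a
  · subst hja; rw [xhat_a, ha]
  by_cases hjb : j = Iq.b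
  · subst hjb; rw [xhat_b, hb]
  by_cases hjc : j = Iq.c
  · subst hjc; rw [xhat_c, hc]
  rw [xhat_other Iq _ j hja hjb hjc]
  simp [xOf, hja, hjb, hjc]

/-- `xOf_xhat` — technical lemma of the R7a free-lift toolkit (val-idea-8 g3). [folklore] -/
theorem xOf_xhat (x : σ →₀ ℕ) (hx : x Iq.a = 0) : xOf Iq (x Iq.b) (x Iq.c) ⇑(xhat Iq x) = x := by
  ext j
  by_cases hjb : j = Iq.b
  · subst hjb; rw [xOf_b]
  by_cases hjc : j = Iq.c
  · subst hjc; rw [xOf_c]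
  by_cases hja : j = Iq.a
  · subst hja; rw [xOf_a, hx]
  simp [xOf, hjb, hjc, hja, xhat_other Iq x j hja hjb hjc]

end Slice

end R7a
end Summit.ValiantsHypothesis.ValiantsHypothesis.Theorems.NewtonUnitEquations.TwoProducts.PermutationType

end
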